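import Summits.KontsevichZagierPeriods.KontsevichZagierPeriods.Theorems.RealOnePeriodRelations.Negative.Kit
import Summits.KontsevichZagierPeriods.KontsevichZagierPeriods.Theorems.SymplecticScissorsRealOnePeriodRelationsStubSaChart
import Summits.KontsevichZagierPeriods.KontsevichZagierPeriods.Theorems.SymplecticScissorsRealOnePeriodRelationsStubSaPathSubset
import Summits.KontsevichZagierPeriods.KontsevichZagierPeriods.Theorems.SymplecticScissorsRealOnePeriodRelationsStubGreenOnSquare
import Summits.KontsevichZagierPeriods.KontsevichZagierPeriods.Theorems.SymplecticScissorsRealOnePeriodRelationsStubCellGreen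
import Summits.KontsevichZagierPeriods.KontsevichZagierPeriods.Theorems.SymplecticScissorsRealOnePeriodRelationsStubHomotopyInvariance
import Summits.KontsevichZagierPeriods.KontsevichZagierPeriods.Theorems.SymplecticScissorsRealOnePeriodRelationsStubSaHomotopic
import Summits.KontsevichZagierPeriods.KontsevichZagierPeriods.Theorems.SymplecticScissorsRealOnePeriodRelationsStubExactDimOne
import Summits.KontsevichZagierPeriods.KontsevichZagierPeriods.Theorems.SymplecticScissorsRealOnePeriodRelationsStubRealises
import Summits.KontsevichZagierPeriods.KontsevichZagierPeriods.Theorems.SymplecticScissorsRealOnePeriodRelationsStubRetraction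
import Summits.KontsevichZagierPeriods.KontsevichZagierPeriods.Theorems.SymplecticScissorsRealOnePeriodRelationsNormalisationReduction
import Summits.KontsevichZagierPeriods.KontsevichZagierPeriods.Theorems.SymplecticScissorsRealOnePeriodRelationsStubRatCells
import Summits.KontsevichZagierPeriods.KontsevichZagierPeriods.Theorems.SymplecticScissorsRealOnePeriodRelationsStubRatReduce
import Summits.KontsevichZagierPeriods.KontsevichZagierPeriods.Theorems.SymplecticScissorsRealOnePeriodRelationsStubRatSymbol
import Summits.KontsevichZagierPeriods.KontsevichZagierPeriods.Theorems.SymplecticScissorsRealOnePeriodRelationsStubLayerGlue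
import Literature.NumberTheory.Transcendental.CurvePeriodsPuncturedLineProofs
import Mathlib.FieldTheory.AlgebraicClosure

/-!
# Crux `RealOnePeriodRelations` (stmt-KontsevichZagierPeriods-10042) — THE RATIONAL LAYER, UNCONDITIONALLY

Line `nash-retraction-thin-strip`, reshape 3 (gen-1 lead).  The crux says: every `ℤ`-combination of one-dimensional
Kontsevich–Zagier integral representations with vanishing value lies in `M₁ = closure (1a ∪ 1b ∪ 2 ∪ Green)`.  Its
general form is proved in the tree only modulo the apex `PeriodConjectureCurveType` (item stmt-14055, Huber–Wüstholz
Thm 13.3 (2) for all curves; `RealOnePeriodRelations_of_periodConjectureCurveType`).  This file proves it WITH NO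
HYPOTHESIS on the RATIONAL LAYER — combinations of representations of Kontsevich–Zagier's literal shape
(`IntegralRep.IsRational`: a `ℚ`-semialgebraic domain in `ℝ`, an integrand which is a quotient of polynomials over
`ℚ`): `realOnePeriodRelations_ratLayer`.  The layer normalisation (`stub_ratCells`, `stub_ratReduce`, `stub_ratSymbol`,
glued by `stub_layerGlue`, all landed) writes such a `c` modulo `M₁` as a sum of real realisations of an algebraic
combination `C` of period symbols on punctured lines `Z_a = {y ∏ (x − aᵢ) = 1}` with `evalCombination C = eval c`;
the genus-0 case of Huber–Wüstholz's theorem, PROVED in the tree from Baker's theorem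
(`CurvePeriods.huberWustholzCurvePeriods_of_puncturedLine`), makes `C` an algebraic combination of elementary relations,
which the landed retraction `Θ` of the line kills modulo `M₁`.
[cite: HuberWustholz2022, Thm 13.3 (2), §3.3.1, Rem. 15.11] [cite: Baker1975, Thm 2.1] [cite: KontsevichZagier2001, §1.1–§1.2]
-/

noncomputable section

open scoped BigOperators Polynomial
open Set MeasureTheory MvPolynomial
open Literature.NumberTheory.Transcendental Literature.NumberTheory.Transcendental.CurvePeriods
open Summit.KontsevichZagierPeriods.SymplecticScissors.RealOnePeriodRelationsNegative (M₁ H₁ crux_iff unitDom)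

namespace Summit.KontsevichZagierPeriods.SymplecticScissors.RealOnePeriodRelations

namespace RationalLayer

/-! ### Assembly of the layer (lead) -/

/-- The integrand of a representation on the unit interval, read as a function on `ℝ`, is integrable on `(0,1)`.
[folklore] -/
theorem integrableOn_of_unitCell (ρ : KZ.IntegralRep 1) (hdom : ρ.domain = {z | z 0 ∈ Set.Ioo (0 : ℝ) 1}) :
    IntegrableOn (fun t : ℝ => ρ.integrand (fun _ => t)) (Set.Ioo (0 : ℝ) 1) := by
  set Φ := MeasurableEquiv.funUnique (Fin 1) ℝ with hΦ
  have hΦe : ⇑Φ.symm = fun t : ℝ => (fun _ : Fin 1 => t) := by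
    funext t i
    rw [hΦ, MeasurableEquiv.funUnique_symm_apply]
    exact uniqueElim_const t i
  have h := ((volume_preserving_funUnique (Fin 1) ℝ).symm Φ).integrableOn_comp_preimage
    Φ.symm.measurableEmbedding (f := ρ.integrand) (s := ρ.domain)
  rw [hΦe] at h
  have h2 := h.mpr ρ.integrableOn
  have hpre : (fun t : ℝ => (fun _ : Fin 1 => t)) ⁻¹' ρ.domain = Set.Ioo (0 : ℝ) 1 := by
    ext t
    rw [hdom]
    simp
  rw [hpre] at h2
  exact h2

/-- The value of a representation on the unit interval is the interval integral of its integrand. [folklore] -/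
theorem value_of_unitCell (ρ : KZ.IntegralRep 1) (hdom : ρ.domain = {z | z 0 ∈ Set.Ioo (0 : ℝ) 1}) :
    ρ.value = ∫ t in (0 : ℝ)..1, ρ.integrand (fun _ => t) := by
  rw [KZ.IntegralRep.value, hdom]
  have h := Summit.KontsevichZagierPeriods.SymplecticScissors.RealOnePeriodRelationsNegative.setIntegral_unitDom
    (fun t => ρ.integrand (fun _ => t))
  rw [← h]
  refine setIntegral_congr_fun
    Summit.KontsevichZagierPeriods.SymplecticScissors.RealOnePeriodRelationsNegative.measurableSet_unitDom
    (fun z _ => ?_)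
  show ρ.integrand z = ρ.integrand (fun _ => z 0)
  congr 1
  exact KZ.eq_const_apply_zero z

/-- ARCS ARE SYMBOLS on the rational layer: a unit rational cell is, modulo `M₁`, the real realisation of one period
symbol on a punctured line, with the same value (from `stub_ratReduce`, `stub_ratSymbol` and the landed
`stub_realises`). [cite: HuberWustholz2022, §3.3.1] -/
theorem ratArcs : ∀ ρ : KZ.IntegralRep 1,
    (ρ.domain = {z | z 0 ∈ Set.Ioo (0 : ℝ) 1} ∧
      ∃ P Q : Polynomial (algebraicClosure ℚ ℝ),
        (∀ t ∈ Set.Ioo (0 : ℝ) 1, Polynomial.aeval t Q ≠ 0) ∧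
        ∀ t ∈ Set.Ioo (0 : ℝ) 1, ρ.integrand (fun _ => t) = Polynomial.aeval t P / Polynomial.aeval t Q) →
    ∃ (C : PeriodSymbol →₀ ℂ) (R : PeriodSymbol → KZ.IntegralRep 1), (∀ s, IsAlgebraic ℚ (C s)) ∧
      (∀ s ∈ C.support, ∃ (r : ℕ) (a : Fin r → ℂ), Function.Injective a ∧ (∀ i, IsAlgebraic ℚ (a i)) ∧
        s.Z = (⟨2, 1, ![X 1 * ∏ i, (X 0 - MvPolynomial.C (a i)) - 1]⟩ : CurveData)) ∧
      (∀ s ∈ C.support, IsSemialgebraicMapOn ℚ {z : Fin 1 → ℝ | z 0 ∈ Set.Icc (0 : ℝ) 1}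
        (fun z => Fin.append (fun i => (s.γ.toFun (z 0) i).re) (fun i => (s.γ.toFun (z 0) i).im))) ∧
      (∀ s ∈ C.support, (R s).domain = {z | z 0 ∈ Set.Ioo (0 : ℝ) 1} ∧ ∀ z ∈ (R s).domain, (R s).integrand z =
        (C s * ∑ i, MvPolynomial.eval (s.γ.toFun (z 0)) (s.ω i) * deriv (fun u => s.γ.toFun u i) (z 0)).re) ∧
      evalCombination C = ((ρ.value : ℝ) : ℂ) ∧ KZ.of ρ - ∑ s ∈ C.support, KZ.of (R s) ∈ M₁ := by
  classical
  rintro ρ ⟨hdom, P, Q, hQ, hf⟩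
  obtain ⟨P₀, Q₀, hQ₀, hf₀⟩ := stub_ratReduce (fun t => ρ.integrand (fun _ => t)) P Q hQ hf
    (integrableOn_of_unitCell ρ hdom)
  obtain ⟨s, hsZ, hSA, hint⟩ := stub_ratSymbol P₀ Q₀ hQ₀
  obtain ⟨R₁, hR₁dom, hR₁⟩ := stub_realises s.Z s.γ hSA s.ω s.ω_algebraic 1 isAlgebraic_one
  refine ⟨Finsupp.single s 1, fun _ => R₁, ?_, ?_, ?_, ?_, ?_, ?_⟩
  · intro t
    by_cases h : t = s
    · subst h; simpa using isAlgebraic_one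
    · rw [Finsupp.single_apply, if_neg (Ne.symm h)]; exact isAlgebraic_zero
  · intro t ht
    rw [Finsupp.support_single _ one_ne_zero, Finset.mem_singleton] at ht
    subst ht
    exact hsZ
  · intro t ht
    rw [Finsupp.support_single _ one_ne_zero, Finset.mem_singleton] at ht
    subst ht
    exact hSA
  · intro t ht
    rw [Finsupp.support_single _ one_ne_zero, Finset.mem_singleton] at ht
    subst ht
    refine ⟨hR₁dom, fun z hz => ?_⟩
    rw [hR₁ z hz, Finsupp.single_eq_same]
  · -- the value
    rw [evalCombination, Finsupp.sum_single_index (by simp), one_mul, PeriodSymbol.period,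
      value_of_unitCell ρ hdom, ← intervalIntegral.integral_ofReal,
      intervalIntegral.integral_of_le zero_le_one, intervalIntegral.integral_of_le zero_le_one,
      integral_Ioc_eq_integral_Ioo, integral_Ioc_eq_integral_Ioo]
    refine setIntegral_congr_fun measurableSet_Ioo fun t ht => ?_
    rw [hint t (Set.Ioo_subset_Icc_self ht), hf₀ t ht]
  · rw [Finsupp.support_single _ one_ne_zero, Finset.sum_singleton]
    refine NormalisationReduction.sub_mem_M₁_of_integrand_eq ρ R₁ hdom hR₁dom fun z hz => ?_
    rw [hR₁ z (by rw [hR₁dom]; rw [hdom] at hz; exact hz), one_mul]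
    have hz' : z 0 ∈ Set.Ioo (0 : ℝ) 1 := by rw [hdom] at hz; exact hz
    rw [hint (z 0) (Set.Ioo_subset_Icc_self hz'), Complex.ofReal_re, ← hf₀ (z 0) hz']
    congr 1
    exact KZ.eq_const_apply_zero z

/-- **THE RATIONAL LAYER OF THE CRUX, UNCONDITIONALLY.**  Every `ℤ`-combination of one-dimensional integral
representations of Kontsevich–Zagier's literal shape (a `ℚ`-semialgebraic domain in `ℝ` and an integrand which is a
quotient of polynomials with rational coefficients) with vanishing value lies in the subgroup generated by domain
additivity (1a), integrand additivity (1b), change of variables (2) and the Green generator.  Proof: the layer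
normalisation (`stub_ratCells`, `ratArcs`, `stub_layerGlue`) writes `c` modulo `M₁` as a sum of real realisations of
an algebraic combination `C` of period symbols on punctured lines with `evalCombination C = eval c = 0`; the
genus-0 case of Huber–Wüstholz's theorem, PROVED in the tree from Baker's theorem
(`CurvePeriods.huberWustholzCurvePeriods_of_puncturedLine`), makes `C` an algebraic combination of elementary
relations; the landed retraction `Θ` of the line kills those modulo `M₁` and agrees with the realisations.
[cite: HuberWustholz2022, Thm 13.3 (2) and Rem. 15.11] [cite: Baker1975, Thm 2.1] [cite: KontsevichZagier2001, §1.2] -/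
theorem realOnePeriodRelations_ratLayer : ∀ c : KZ.FormalRep,
    c ∈ AddSubgroup.closure ((fun r : KZ.IntegralRep 1 => KZ.of r) '' {r | r.IsRational}) →
    KZ.eval c = 0 →
    c ∈ AddSubgroup.closure (KZ.domainAddRel ∪ KZ.integrandAddRel ∪ KZ.changeOfVariablesRel ∪
      {g : KZ.FormalRep | ∃ (Δ : Set (Fin 2 → ℝ)) (A B S : (Fin 2 → ℝ) → ℝ) (r₀₁ r₁₂ r₀₂ : KZ.IntegralRep 1),
        Δ = {p | 0 ≤ p 0 ∧ 0 ≤ p 1 ∧ p 0 + p 1 ≤ 1} ∧ IsSemialgebraicFunOn ℚ Δ A ∧ IsSemialgebraicFunOn ℚ Δ B ∧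
        ContinuousOn A Δ ∧ ContinuousOn B Δ ∧
        (∀ p : Fin 2 → ℝ, 0 < p 0 → 0 < p 1 → p 0 + p 1 < 1 →
          HasFDerivAt S (A p • ContinuousLinearMap.proj (R := ℝ) (φ := fun _ : Fin 2 => ℝ) 0 +
            B p • ContinuousLinearMap.proj (R := ℝ) (φ := fun _ : Fin 2 => ℝ) 1) p) ∧
        r₀₁.domain = {z | z 0 ∈ Set.Ioo 0 1} ∧ r₁₂.domain = {z | z 0 ∈ Set.Ioo 0 1} ∧
        r₀₂.domain = {z | z 0 ∈ Set.Ioo 0 1} ∧ (∀ z ∈ r₀₁.domain, r₀₁.integrand z = A ![z 0, 0]) ∧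
        (∀ z ∈ r₁₂.domain, r₁₂.integrand z = B ![1 - z 0, z 0] - A ![1 - z 0, z 0]) ∧
        (∀ z ∈ r₀₂.domain, r₀₂.integrand z = B ![0, z 0]) ∧ g = KZ.of r₀₁ + KZ.of r₁₂ - KZ.of r₀₂}) := by
  intro c hc heval
  change c ∈ M₁
  obtain ⟨C, R, hCalg, hCsupp, hSA, hReal, hCeval, hcR⟩ :=
    stub_layerGlue _ _ _ stub_ratCells ratArcs c hc
  have hC0 : evalCombination C = 0 := by rw [hCeval, heval]; simp
  obtain ⟨k, ρ, a, hρ, ha, hCsum⟩ :=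
    huberWustholzCurvePeriods_of_puncturedLine C hCalg (fun s hs => Or.inl (hCsupp s hs)) hC0
  obtain ⟨Θ, hΘrel, hΘreal⟩ :=
    stub_retraction (stub_saHomotopic stub_saChart (stub_saPathSubset stub_saChart))
      (stub_homotopyInvariance stub_saChart (stub_saPathSubset stub_saChart) (stub_cellGreen stub_greenOnSquare))
      stub_exactDimOne stub_realises
  have h1 : (∑ s ∈ C.support, Θ (C s) s) ∈ M₁ := by
    have h := hΘrel k ρ a hρ ha
    rw [← hCsum] at h
    exact h
  have h2 : (∑ s ∈ C.support, (Θ (C s) s - KZ.of (R s))) ∈ M₁ :=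
    sum_mem fun s hs => hΘreal s (C s) (hCalg s) (hSA s hs) (R s) (hReal s hs)
  have h3 : c = (c - ∑ s ∈ C.support, KZ.of (R s)) - (∑ s ∈ C.support, (Θ (C s) s - KZ.of (R s))) +
      ∑ s ∈ C.support, Θ (C s) s := by
    rw [Finset.sum_sub_distrib]
    abel
  rw [h3]
  exact M₁.add_mem (M₁.sub_mem hcR h2) h1

end RationalLayer

end Summit.KontsevichZagierPeriods.SymplecticScissors.RealOnePeriodRelations

end
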